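import Mathlib
import Summits.Ventures.PercRepro.TriangleCapTwoTrianglesEightD

/-!
# PercRepro — THE ONE-TRIANGLE CASE OF THE `r = 2` STABILITY BY THE FAR COUNT: EVERY `k`, GIVEN AN OUTER VERTEX OR
`m ≥ 2k` (p3, gen 37; part 69)

`S = {u, v, w}` the only triangle: every `z ∉ S` has at most one neighbour in `S` (`s(z) ∈ {0, 1}`), `Q = 6`, and
`W(z) = 2 s(z)`.  The far count (`6 ≤ far(z) + 4 s(z)` off `S`; the block `Sᶜ × Sᶜ` pays `3 Σ d − 2 Σ s d` to `S`) and
`2m = 6 + 2 Σ s + Σ d` give **`one_triangle_deficit_lower`**: `Σ_p deficit(p) + 6 ≥ 6q + 2m`, `q` the number of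
outer vertices.  Hence the `r = 2` cell (`Σ deficit ≥ 4k − 6`) for EVERY `k` as soon as there is an outer vertex
and `m ≥ 2k − 3` (**`one_triangle_stability_two_of_outer`**), or `m ≥ 2k` (**`one_triangle_stability_two_of_two_mul`**).
Axioms: standard.
-/

namespace PercRepro

namespace TriangleCap

namespace C047

open Finset

variable {V : Type*} [Fintype V] [DecidableEq V]

/-- **THE ONE-TRIANGLE FAR COUNT:** `6 |Sᶜ| + 3 Σ_{z ∉ S} degIn Sᶜ z ≤ Σ deficit + 4 Σ_{z ∉ S} degIn S z +
2 Σ_{z ∉ S} degIn S z · degIn Sᶜ z` for a triangle `S = {u, v, w}`. -/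
theorem one_triangle_far_count (D : SimpleGraph V) [DecidableRel D.Adj] {u v w : V}
    (huv : D.Adj u v) (huw : D.Adj u w) (hvw : D.Adj v w) :
    6 * (({u, v, w} : Finset V)ᶜ).card + 3 * ∑ z ∈ ({u, v, w} : Finset V)ᶜ, degIn D ({u, v, w} : Finset V)ᶜ z ≤
      ∑ p ∈ adjPairsAll D, deficit D p + 4 * ∑ z ∈ ({u, v, w} : Finset V)ᶜ, degIn D {u, v, w} z +
      2 * ∑ z ∈ ({u, v, w} : Finset V)ᶜ, degIn D {u, v, w} z * degIn D ({u, v, w} : Finset V)ᶜ z := by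
  set S : Finset V := {u, v, w} with hS
  have h3 : S.card = 3 := card_triple huv.ne huw.ne hvw.ne
  have hcl := clique_triple D huv huw hvw
  rw [sum_deficit_eq_sum_far, ← sum_add_sum_compl S]
  -- `Q = 6`, `degIn S x = 2` on `S`
  have hQ : adjPairs D S = 6 := by
    rw [adjPairs_eq_sum_degIn, sum_congr rfl (fun x hx => degIn_self_of_clique D h3 hcl hx), sum_const, h3,
      smul_eq_mul]
  have hW : ∀ z, ∑ x ∈ S.filter (fun x => D.Adj z x), degIn D S x = 2 * degIn D S z := by
    intro z
    rw [sum_congr rfl (fun x hx => degIn_self_of_clique D h3 hcl (mem_filter.mp hx).1), sum_const, smul_eq_mul,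
      mul_comm]
    rfl
  have hR : 6 * Sᶜ.card ≤ ∑ z ∈ Sᶜ, far D z + 4 * ∑ z ∈ Sᶜ, degIn D S z := by
    rw [mul_sum, ← sum_add_distrib]
    have : 6 * Sᶜ.card = ∑ _z ∈ Sᶜ, 6 := by rw [sum_const, smul_eq_mul, mul_comm]
    rw [this]
    apply sum_le_sum
    intro z _
    have := adjPairs_le_far_add D S z
    rw [hQ, hW] at this
    omega
  have hSfar := sum_far_eq_double D S
  rw [double_sum_split S] at hSfar
  have ho := block_outside D S
  rw [h3] at ho
  omega

/-- **`Σ deficit + 6 ≥ 6 q + 2 m`** for the only triangle `S = {u, v, w}`, `q` the number of outer vertices. -/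
theorem one_triangle_deficit_lower (D : SimpleGraph V) [DecidableRel D.Adj] (hK : K4mFree D) {u v w : V}
    (huv : D.Adj u v) (huw : D.Adj u w) (hvw : D.Adj v w) :
    6 * ((({u, v, w} : Finset V)ᶜ).filter (fun z => degIn D {u, v, w} z = 0)).card + 2 * D.edgeFinset.card ≤
      ∑ p ∈ adjPairsAll D, deficit D p + 6 := by
  set S : Finset V := {u, v, w} with hS
  have h3 : S.card = 3 := card_triple huv.ne huw.ne hvw.ne
  have hcl := clique_triple D huv huw hvw
  have hcount := one_triangle_far_count D huv huw hvw
  rw [← hS] at hcount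
  have hQ : adjPairs D S = 6 := by
    rw [adjPairs_eq_sum_degIn, sum_congr rfl (fun x hx => degIn_self_of_clique D h3 hcl hx), sum_const, h3,
      smul_eq_mul]
  have hdens := two_mul_card_edges_eq_adjPairs_add D S
  rw [hQ] at hdens
  have hone : ∀ z ∈ Sᶜ, degIn D S z ≤ 1 := fun z hz =>
    degIn_le_one_of_triangle D hK huv huw hvw (mem_compl.mp hz)
  -- `Σ s d ≤ Σ d` and `Σ s = |Sᶜ| − q`
  have hsd : ∑ z ∈ Sᶜ, degIn D S z * degIn D Sᶜ z ≤ ∑ z ∈ Sᶜ, degIn D Sᶜ z := by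
    apply sum_le_sum
    intro z hz
    have := hone z hz
    nlinarith
  have hs : ∑ z ∈ Sᶜ, degIn D S z + (Sᶜ.filter (fun z => degIn D S z = 0)).card = Sᶜ.card := by
    rw [card_filter, ← sum_add_distrib, card_eq_sum_ones]
    apply sum_congr rfl
    intro z hz
    have := hone z hz
    by_cases h0 : degIn D S z = 0
    · simp only [h0, if_true]
    · simp only [h0, if_false]; omega
  omega

/-- **THE ONE-TRIANGLE CASE WITH AN OUTER VERTEX, EVERY `k`:** `K₄⁻`-free, the only triangle `u v w`, some vertex
adjacent to none of `u, v, w`, `m ≥ 2k − 3` ⇒ `Σ_v d(v)² + 2 (k − 3) ≤ m k`. -/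
theorem one_triangle_stability_two_of_outer (D : SimpleGraph V) [DecidableRel D.Adj] (hK : K4mFree D)
    {u v w : V} (huv : D.Adj u v) (huw : D.Adj u w) (hvw : D.Adj v w)
    (hT : ∀ a b c, D.Adj a b → D.Adj a c → D.Adj b c → a = u ∨ a = v ∨ a = w)
    (hm : 2 * Fintype.card V ≤ D.edgeFinset.card + 3)
    (hout : ∃ z, z ∉ ({u, v, w} : Finset V) ∧ degIn D {u, v, w} z = 0) :
    ∑ v, deg D v * deg D v + 2 * (Fintype.card V - 3) ≤ D.edgeFinset.card * Fintype.card V := by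
  have hlow := one_triangle_deficit_lower D hK huv huw hvw
  have hq : 1 ≤ ((({u, v, w} : Finset V)ᶜ).filter (fun z => degIn D {u, v, w} z = 0)).card := by
    obtain ⟨z, hz, hz0⟩ := hout
    apply card_pos.mpr
    exact ⟨z, mem_filter.mpr ⟨mem_compl.mpr hz, hz0⟩⟩
  have h6 := card_triangles3_le_six D hT
  have hid := two_mul_sum_deg_sq_add_sum_deficit D
  have hmk : 2 * (D.edgeFinset.card * Fintype.card V) = 2 * D.edgeFinset.card * Fintype.card V := by ring
  have hk3 : 3 ≤ Fintype.card V := by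
    have : ({u, v, w} : Finset V).card ≤ Fintype.card V := card_le_univ _
    rw [card_triple huv.ne huw.ne hvw.ne] at this
    exact this
  omega

/-- **THE ONE-TRIANGLE CASE WITH `m ≥ 2k`, EVERY `k`.** -/
theorem one_triangle_stability_two_of_two_mul (D : SimpleGraph V) [DecidableRel D.Adj] (hK : K4mFree D)
    {u v w : V} (huv : D.Adj u v) (huw : D.Adj u w) (hvw : D.Adj v w)
    (hT : ∀ a b c, D.Adj a b → D.Adj a c → D.Adj b c → a = u ∨ a = v ∨ a = w)
    (hm : 2 * Fintype.card V ≤ D.edgeFinset.card) :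
    ∑ v, deg D v * deg D v + 2 * (Fintype.card V - 3) ≤ D.edgeFinset.card * Fintype.card V := by
  have hlow := one_triangle_deficit_lower D hK huv huw hvw
  have h6 := card_triangles3_le_six D hT
  have hid := two_mul_sum_deg_sq_add_sum_deficit D
  have hmk : 2 * (D.edgeFinset.card * Fintype.card V) = 2 * D.edgeFinset.card * Fintype.card V := by ring
  have hk3 : 3 ≤ Fintype.card V := by
    have : ({u, v, w} : Finset V).card ≤ Fintype.card V := card_le_univ _
    rw [card_triple huv.ne huw.ne hvw.ne] at this
    exact this
  omega

end C047

end TriangleCap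

end PercRepro
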